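import Mathlib.Analysis.SpecialFunctions.OrdinaryHypergeometric
import Mathlib.Analysis.SpecialFunctions.Trigonometric.InverseDeriv
import Mathlib.Analysis.SpecialFunctions.Sqrt
import Mathlib.Analysis.SpecialFunctions.Pow.Real
import Literature.Probability.RandomPlanarGeometry.CardyFunction
import Literature.Probability.RandomPlanarGeometry.CardyFunctionIncBeta
import HarnessLib

/-!
# Miller–Werner `CLE_κ` hook-up probabilities (explicit formula)

For `κ ∈ (8/3, 8)`, a `CLE_κ` in a conformal rectangle with *wired* boundary conditions on two
opposite arcs hooks the two wired arcs up into one single loop with a conformally invariant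
probability `H_κ(x)`, `x ∈ (0,1)` the cross-ratio (of `(∞, 0, 1-x, 1)` in `ℍ`, wired arcs
`(-∞,0)` and `(1-x,1)`). By Dubédat's commutation relations (Miller–Werner 2018, §4)
`H_κ(x) = Z_κ(x) / (Z_κ(x) + θ_κ Z_κ(1-x))` with
`Z_κ(x) = x^{2/κ} (1-x)^{1-6/κ} ₂F₁(4/κ, 1-4/κ; 8/κ; x)`, and Theorem 1 of that paper is
`θ_κ = -2cos(4π/κ)`; so a conformal square hooks up with probability `1/(1 - 2cos(4π/κ))`, and
`θ_κ` is the loop weight `N` of the O(`N`) model, resp. `√q` of critical FK(`q`) percolation.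

This file records these EXPLICIT REAL FUNCTIONS of `(κ, x)` (not the `CLE_κ` events, whose law
is not constructed in `Literature/`; cf. `IsCLEFamily`) and the elementary special values tying
them to the library: `θ = 1, √2, 2, 0` at `κ = 6, 16/3, 4, 8`; `H_κ(1/2) = 1/(1+θ_κ)`;
`κ = 6`: `Z₆ = cardyFunction / cardyConst`, `H₆ = cardyFunction` on `[0,1]` (Cardy);
`κ = 16/3`: `H(1/2) = 1/(1+√2)` (FK-Ising); the FK dictionary
`√q = -2cos(4π/κ) ⇔ κ = 4π/arccos(-√q/2)` on `q ∈ [0,4]`, `κ ∈ [4,8]` (Smirnov, ICM 2006,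
Conj. 4) with `κ(0,1,2,4) = 8, 6, 16/3, 4` and the slope `dκ/dq(1) = -3√3/(2π)`.

## Design / junk values

* `Real.rpow` and Mathlib's `₂F₁` (junk value `0` outside the disc of convergence) are total, so
  `Z`, `θ`, `H` are total in `(κ, x)`; they carry their meaning for `κ ∈ (8/3, 8)`, `x ∈ (0,1)`.
  Division by zero gives `H = 0` as junk.
* The body of `millerWernerZ` is literally the `let Z` inlined in route statements of
  `Summits/CriticalPhenomena/CardyFormulaZ2` (item `stmt-CriticalPhenomena-7113`): restate by `rfl`.
* NOT here: the hook-up event and `P[hook-up] = H_κ(x)` (needs wired `CLE_κ`); differentiability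
  of `κ ↦ H_κ(x)` (parameter-derivatives of `₂F₁`).

## References

* J. Miller, W. Werner, *Connection probabilities for conformal loop ensembles*, Comm. Math.
  Phys. 362 (2018) 415–453 (arXiv:1702.02919): Theorem 1, §4 (formulas for `H`, `Z`, `f`).
* S. Smirnov, *Towards conformal invariance of 2D lattice models*, Proc. ICM 2006, Vol. II,
  §2.3 Conjecture 4 (`κ = 4π / arccos(-√q/2)`).
* J. Cardy, *Critical percolation in finite geometries*, J. Phys. A 25 (1992) L201 (`κ = 6`).
-/

noncomputable section

namespace Literature.Probability.RandomPlanarGeometry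

open Real Set

section Defs

/-- The Miller–Werner partition function `Z_κ(x) = x^{2/κ} (1-x)^{1-6/κ} ₂F₁(4/κ, 1-4/κ; 8/κ; x)`
of a `CLE_κ` conformal rectangle with two wired arcs and cross-ratio `x ∈ (0,1)`
(Miller–Werner 2018, §4, the displayed formulas for `Z` and `f`; `κ ∈ (8/3, 8)` intended, total
with Mathlib junk values elsewhere). [cite: MillerWerner2018, §4] -/
def millerWernerZ (κ x : ℝ) : ℝ :=
  x ^ (2 / κ) * (1 - x) ^ (1 - 6 / κ) * ₂F₁ (4 / κ) (1 - 4 / κ) (8 / κ) x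

/-- The Miller–Werner constant `θ_κ = -2 cos(4π/κ)` (Miller–Werner 2018, Theorem 1); it equals the
loop weight `N ∈ (0,2]` of the O(`N`) model, resp. `√q` of FK(`q`) percolation, conjecturally
described by `CLE_κ`. [cite: MillerWerner2018, Thm 1] -/
def millerWernerTheta (κ : ℝ) : ℝ :=
  -2 * Real.cos (4 * π / κ)

/-- The Miller–Werner `CLE_κ` hook-up (connection) probability
`H_κ(x) = Z_κ(x) / (Z_κ(x) + θ_κ Z_κ(1-x))` of a conformal rectangle with two wired arcs, as a
function of `κ ∈ (8/3, 8)` and the cross-ratio `x ∈ (0,1)` (Miller–Werner 2018, §4 formula for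
`H` with `θ = θ_κ = -2cos(4π/κ)` from Theorem 1). Total; junk (`= 0`) where the denominator
vanishes. [cite: MillerWerner2018, §4] -/
def millerWernerHookup (κ x : ℝ) : ℝ :=
  millerWernerZ κ x / (millerWernerZ κ x + millerWernerTheta κ * millerWernerZ κ (1 - x))

/-- Unfolding of `millerWernerZ` (the form inlined as `let Z` in route statements).
[cite: MillerWerner2018, §4] -/
theorem millerWernerZ_eq (κ x : ℝ) :
    millerWernerZ κ x =
      x ^ (2 / κ) * (1 - x) ^ (1 - 6 / κ) * ₂F₁ (4 / κ) (1 - 4 / κ) (8 / κ) x :=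
  rfl

/-- Unfolding of `millerWernerHookup`. [cite: MillerWerner2018, §4] -/
theorem millerWernerHookup_eq (κ x : ℝ) :
    millerWernerHookup κ x =
      millerWernerZ κ x /
        (millerWernerZ κ x + millerWernerTheta κ * millerWernerZ κ (1 - x)) :=
  rfl

/-- Unfolding of `millerWernerTheta`. [cite: MillerWerner2018, Thm 1] -/
theorem millerWernerTheta_eq (κ : ℝ) : millerWernerTheta κ = -2 * Real.cos (4 * π / κ) := rfl

end Defs

/-! ### Special values of `θ_κ` -/

section Theta

/-- `θ₆ = -2cos(2π/3) = 1` (percolation, `q = 1`). [cite: MillerWerner2018, Thm 1] -/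
theorem millerWernerTheta_six : millerWernerTheta 6 = 1 := by
  rw [millerWernerTheta_eq, show 4 * π / 6 = π - π / 3 by ring, Real.cos_pi_sub,
    Real.cos_pi_div_three]
  norm_num

/-- `θ_{16/3} = -2cos(3π/4) = √2` (FK-Ising, `q = 2`). [cite: MillerWerner2018, Thm 1] -/
theorem millerWernerTheta_sixteen_thirds : millerWernerTheta (16 / 3) = Real.sqrt 2 := by
  rw [millerWernerTheta_eq, show 4 * π / (16 / 3) = π - π / 4 by ring, Real.cos_pi_sub,
    Real.cos_pi_div_four]
  ring

/-- `θ₄ = -2cos(π) = 2` (`q = 4`; square hook-up probability `1/3`). [cite: MillerWerner2018, Thm 1] -/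
theorem millerWernerTheta_four : millerWernerTheta 4 = 2 := by
  rw [millerWernerTheta_eq, show 4 * π / 4 = π by ring, Real.cos_pi]
  norm_num

/-- `θ₈ = -2cos(π/2) = 0` (the boundary value `κ = 8`, `q = 0`). [cite: MillerWerner2018, Thm 1] -/
theorem millerWernerTheta_eight : millerWernerTheta 8 = 0 := by
  rw [millerWernerTheta_eq, show 4 * π / 8 = π / 2 by ring, Real.cos_pi_div_two]
  norm_num

/-- `θ_{8/3} = -2cos(3π/2) = 0` (the boundary value `κ = 8/3`, `N = 0`). [cite: MillerWerner2018, Thm 1] -/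
theorem millerWernerTheta_eight_thirds : millerWernerTheta (8 / 3) = 0 := by
  rw [millerWernerTheta_eq, show 4 * π / (8 / 3) = 2 * π - π / 2 by ring, Real.cos_two_pi_sub,
    Real.cos_pi_div_two]
  norm_num

/-- For `κ ∈ [4, 8]` one has `4π/κ ∈ [π/2, π]`, hence `θ_κ = -2cos(4π/κ) ≥ 0`. [folklore] -/
theorem millerWernerTheta_nonneg {κ : ℝ} (hκ : κ ∈ Icc (4 : ℝ) 8) : 0 ≤ millerWernerTheta κ := by
  have hκ0 : 0 < κ := by linarith [hκ.1]
  have hlo : π / 2 ≤ 4 * π / κ := by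
    rw [div_le_div_iff₀ two_pos hκ0]
    nlinarith [Real.pi_pos, hκ.2]
  have hhi : 4 * π / κ ≤ π + π / 2 := by
    rw [div_le_iff₀ hκ0]
    nlinarith [Real.pi_pos, hκ.1]
  have hcos := Real.cos_nonpos_of_pi_div_two_le_of_le hlo hhi
  rw [millerWernerTheta_eq]
  linarith

end Theta

/-! ### Positivity of the Gauss series and of `Z_κ` -/

section Positivity

/-- `(a)_n ≥ 0` for `a ≥ 0` (ascending Pochhammer symbol at a nonnegative real). [folklore] -/
theorem ascPochhammer_eval_nonneg_of_nonneg {a : ℝ} (ha : 0 ≤ a) (n : ℕ) :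
    0 ≤ (ascPochhammer ℝ n).eval a := by
  induction n with
  | zero => simp
  | succ n ih =>
    rw [ascPochhammer_succ_eval]
    exact mul_nonneg ih (by positivity)

/-- For real parameters `a, b ≥ 0` and `c > 0` the Gauss series `₂F₁(a,b;c;·)` has radius of
convergence at least `1` (it is `1`, or `∞` when `a = 0` or `b = 0` and the series terminates;
Mathlib's `ordinaryHypergeometricSeries_radius_eq_one`). [folklore] -/
theorem one_le_ordinaryHypergeometricSeries_radius_of_nonneg {a b c : ℝ} (ha : 0 ≤ a)
    (hb : 0 ≤ b) (hc : 0 < c) : 1 ≤ (ordinaryHypergeometricSeries ℝ a b c).radius := by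
  rcases ha.eq_or_lt with rfl | ha'
  · have h := ordinaryHypergeometric_radius_top_of_neg_nat₁ ℝ b c (k := 0) (𝕂 := ℝ)
    rw [Nat.cast_zero, neg_zero] at h
    rw [h]
    exact le_top
  rcases hb.eq_or_lt with rfl | hb'
  · have h := ordinaryHypergeometric_radius_top_of_neg_nat₂ ℝ a c (k := 0) (𝕂 := ℝ)
    rw [Nat.cast_zero, neg_zero] at h
    rw [h]
    exact le_top
  rw [ordinaryHypergeometricSeries_radius_eq_one ℝ a b c fun k => ?_]
  have hk : (0 : ℝ) ≤ k := k.cast_nonneg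
  exact ⟨by intro h; linarith, by intro h; linarith, by intro h; linarith⟩

/-- For `a, b ≥ 0`, `c > 0` and `0 ≤ x < 1` the Gauss series converges to its sum `₂F₁(a,b;c;x)`
and all its terms are nonnegative with zeroth term `1`; hence `1 ≤ ₂F₁(a,b;c;x)`. [folklore] -/
theorem one_le_ordinaryHypergeometric_of_nonneg {a b c x : ℝ} (ha : 0 ≤ a) (hb : 0 ≤ b)
    (hc : 0 < c) (hx0 : 0 ≤ x) (hx1 : x < 1) : 1 ≤ ₂F₁ a b c x := by
  set p := ordinaryHypergeometricSeries ℝ a b c with hp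
  have hmem : x ∈ Metric.eball (0 : ℝ) p.radius := by
    rw [Metric.mem_eball, edist_zero_right, ← ofReal_norm, Real.norm_eq_abs, abs_of_nonneg hx0]
    exact lt_of_lt_of_le (ENNReal.ofReal_lt_one.2 hx1)
      (one_le_ordinaryHypergeometricSeries_radius_of_nonneg ha hb hc)
  have hsum : HasSum (fun n : ℕ => p n fun _ => x) (₂F₁ a b c x) := p.hasSum hmem
  have hterm : ∀ n : ℕ, 0 ≤ p n fun _ => x := by
    intro n
    rw [hp, ordinaryHypergeometricSeries_apply_eq, smul_eq_mul]
    have h1 := ascPochhammer_eval_nonneg_of_nonneg ha n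
    have h2 := ascPochhammer_eval_nonneg_of_nonneg hb n
    have h3 := ascPochhammer_pos n c hc
    positivity
  have h0 : (p 0 fun _ => x) = 1 := by
    rw [hp, ordinaryHypergeometricSeries_apply_eq, smul_eq_mul]
    simp
  rw [← h0]
  exact le_hasSum hsum 0 fun j _ => hterm j

/-- For `κ ≥ 4` the parameters `4/κ, 1-4/κ ≥ 0`, `8/κ > 0` of `f_κ` are admissible, so
`Z_κ(x) > 0` for `x ∈ (0,1)`. [folklore] -/
theorem millerWernerZ_pos {κ x : ℝ} (hκ : 4 ≤ κ) (hx : x ∈ Ioo (0 : ℝ) 1) :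
    0 < millerWernerZ κ x := by
  have hκ0 : 0 < κ := by linarith
  have ha : 0 ≤ 4 / κ := by positivity
  have hb : 0 ≤ 1 - 4 / κ := by
    rw [sub_nonneg, div_le_one hκ0]
    exact hκ
  have hc : 0 < 8 / κ := by positivity
  have hF := one_le_ordinaryHypergeometric_of_nonneg ha hb hc hx.1.le hx.2
  have h1 : 0 < x ^ (2 / κ) := Real.rpow_pos_of_pos hx.1 _
  have h2 : 0 < (1 - x) ^ (1 - 6 / κ) := Real.rpow_pos_of_pos (by linarith [hx.2]) _
  have h3 : 0 < ₂F₁ (4 / κ) (1 - 4 / κ) (8 / κ) x := by linarith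
  rw [millerWernerZ_eq]
  positivity

end Positivity

/-! ### The conformal square: `H_κ(1/2) = 1/(1 + θ_κ)` -/

section Square

/-- **Miller–Werner, Theorem 1 (square form).** At cross-ratio `x = 1/2` (a conformal square)
`H_κ(1/2) = 1/(1 + θ_κ) = 1/(1 - 2cos(4π/κ))`, provided `Z_κ(1/2) ≠ 0` (automatic for
`κ ≥ 4`, see `millerWernerHookup_one_half_of_four_le`). [cite: MillerWerner2018, Thm 1] -/
theorem millerWernerHookup_one_half {κ : ℝ} (hZ : millerWernerZ κ (1 / 2) ≠ 0) :
    millerWernerHookup κ (1 / 2) = 1 / (1 + millerWernerTheta κ) := by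
  rw [millerWernerHookup_eq, show (1 : ℝ) - 1 / 2 = 1 / 2 by norm_num]
  have h : millerWernerZ κ (1 / 2) + millerWernerTheta κ * millerWernerZ κ (1 / 2) =
      millerWernerZ κ (1 / 2) * (1 + millerWernerTheta κ) := by ring
  rw [h, div_mul_eq_div_div, div_self hZ]

/-- For `κ ≥ 4`: `H_κ(1/2) = 1/(1 - 2cos(4π/κ))` unconditionally. [cite: MillerWerner2018, Thm 1] -/
theorem millerWernerHookup_one_half_of_four_le {κ : ℝ} (hκ : 4 ≤ κ) :
    millerWernerHookup κ (1 / 2) = 1 / (1 - 2 * Real.cos (4 * π / κ)) := by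
  have hx : (1 / 2 : ℝ) ∈ Ioo (0 : ℝ) 1 := ⟨by norm_num, by norm_num⟩
  rw [millerWernerHookup_one_half (millerWernerZ_pos hκ hx).ne', millerWernerTheta_eq]
  ring

/-- FK-Ising value (`κ = 16/3`, `θ = √2`): the `CLE_{16/3}` hook-up probability of a conformal
square is `1/(1+√2)`. [cite: MillerWerner2018, Thm 1] -/
theorem millerWernerHookup_sixteen_thirds_one_half :
    millerWernerHookup (16 / 3) (1 / 2) = 1 / (1 + Real.sqrt 2) := by
  have hx : (1 / 2 : ℝ) ∈ Ioo (0 : ℝ) 1 := ⟨by norm_num, by norm_num⟩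
  rw [millerWernerHookup_one_half (millerWernerZ_pos (by norm_num) hx).ne',
    millerWernerTheta_sixteen_thirds]

/-- `q = 4` value (`κ = 4`, `θ = 2`): the square hook-up probability is `1/3`, the minimum over
`κ` (Miller–Werner 2018, discussion after Thm 1). [cite: MillerWerner2018, Thm 1] -/
theorem millerWernerHookup_four_one_half : millerWernerHookup 4 (1 / 2) = 1 / 3 := by
  have hx : (1 / 2 : ℝ) ∈ Ioo (0 : ℝ) 1 := ⟨by norm_num, by norm_num⟩
  rw [millerWernerHookup_one_half (millerWernerZ_pos le_rfl hx).ne', millerWernerTheta_four]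
  norm_num

end Square

/-! ### `κ = 6`: Cardy's formula -/

section Six

/-- At `κ = 6` the parameters are `(2/3, 1/3; 4/3)` and the `(1-x)` power disappears:
`Z₆(x) = x^{1/3} ₂F₁(2/3, 1/3; 4/3; x) = cardyFunction x / cardyConst` for every real `x`
(symmetry of `₂F₁` in its first two parameters). [cite: MillerWerner2018, §4] -/
theorem millerWernerZ_six (x : ℝ) : millerWernerZ 6 x = cardyFunction x / cardyConst := by
  rw [millerWernerZ_eq, cardyFunction_eq_cardyConst_mul, show (2 : ℝ) / 6 = 1 / 3 by norm_num,
    show (1 : ℝ) - 6 / 6 = 0 by norm_num, Real.rpow_zero, mul_one,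
    show (4 : ℝ) / 6 = 2 / 3 by norm_num, show (1 : ℝ) - 2 / 3 = 1 / 3 by norm_num,
    show (8 : ℝ) / 6 = 4 / 3 by norm_num]
  have hsymm : ₂F₁ (2 / 3 : ℝ) (1 / 3 : ℝ) (4 / 3 : ℝ) x = ₂F₁ (1 / 3 : ℝ) (2 / 3 : ℝ) (4 / 3 : ℝ) x := by
    simp only [ordinaryHypergeometric, ordinaryHypergeometricSeries_symm]
  rw [hsymm]
  field_simp [cardyConst_pos.ne']

/-- **`H₆ = F` (Cardy's formula as the `κ = 6` member of the Miller–Werner family).** Since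
`θ₆ = 1` and `F(x) + F(1-x) = 1`, `H₆(x) = F(x)/(F(x) + F(1-x)) = cardyFunction x` for
`x ∈ [0,1]`. [cite: MillerWerner2018, §1] -/
theorem millerWernerHookup_six {x : ℝ} (hx : x ∈ Icc (0 : ℝ) 1) :
    millerWernerHookup 6 x = cardyFunction x := by
  have h1 : cardyFunction (1 - x) = 1 - cardyFunction x := cardyFunction_one_sub_holds hx
  rw [millerWernerHookup_eq, millerWernerZ_six, millerWernerZ_six, millerWernerTheta_six, h1,
    one_mul]
  have hC := cardyConst_pos.ne'
  rw [← add_div, add_sub_cancel, div_div_div_cancel_right₀ hC, div_one]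

/-- In particular `H₆(1/2) = 1/2` (`θ₆ = 1`). [cite: MillerWerner2018, Thm 1] -/
theorem millerWernerHookup_six_one_half : millerWernerHookup 6 (1 / 2) = 1 / 2 := by
  rw [millerWernerHookup_one_half_of_four_le (by norm_num), show 4 * π / 6 = π - π / 3 by ring,
    Real.cos_pi_sub, Real.cos_pi_div_three]
  norm_num

end Six

/-! ### The FK dictionary `√q = -2cos(4π/κ)` -/

section FK

/-- The FK(`q`)–`κ` dictionary `κ(q) = 4π / arccos(-√q/2)`: for `q ∈ [0,4]` the unique
`κ ∈ [4,8]` with `√q = -2cos(4π/κ)` (Smirnov, ICM 2006, §2.3 Conjecture 4; Miller–Werner 2018,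
§1). Junk outside `q ∈ [0,4]` (`Real.sqrt`, `Real.arccos` conventions). [cite: Smirnov2007ICM, §2.3 Conjecture 4] -/
def fkKappa (q : ℝ) : ℝ :=
  4 * π / Real.arccos (-Real.sqrt q / 2)

/-- Unfolding of `fkKappa`. [cite: Smirnov2007ICM, §2.3 Conjecture 4] -/
theorem fkKappa_eq (q : ℝ) : fkKappa q = 4 * π / Real.arccos (-Real.sqrt q / 2) := rfl

/-- For `q ≤ 4` the argument `-√q/2` lies in `[-1, 0]`, so `arccos(-√q/2) ∈ [π/2, π]`. [folklore] -/
theorem arccos_fk_mem_Icc {q : ℝ} (hq4 : q ≤ 4) :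
    Real.arccos (-Real.sqrt q / 2) ∈ Icc (π / 2) π := by
  have _hs : Real.sqrt q ≤ 2 := by
    rw [Real.sqrt_le_left (by norm_num : (0 : ℝ) ≤ 2)]
    linarith
  refine ⟨?_, Real.arccos_le_pi _⟩
  have h0 : -Real.sqrt q / 2 ≤ 0 := by
    have := Real.sqrt_nonneg q
    linarith
  exact not_lt.1 fun h => (not_lt.2 h0) (Real.arccos_lt_pi_div_two.1 h)

/-- `θ_{κ(q)} = √q` for `q ∈ [0,4]`: `-2cos(arccos(-√q/2)) = √q`. [folklore] -/
theorem millerWernerTheta_fkKappa {q : ℝ} (hq0 : 0 ≤ q) (hq4 : q ≤ 4) :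
    millerWernerTheta (fkKappa q) = Real.sqrt q := by
  have hs : Real.sqrt q ≤ 2 := by
    rw [Real.sqrt_le_left (by norm_num : (0 : ℝ) ≤ 2)]
    linarith
  have hs0 := Real.sqrt_nonneg q
  have h1 : -1 ≤ -Real.sqrt q / 2 := by linarith
  have h2 : -Real.sqrt q / 2 ≤ 1 := by linarith
  have hpos : 0 < Real.arccos (-Real.sqrt q / 2) :=
    lt_of_lt_of_le (by positivity) (arccos_fk_mem_Icc hq4).1
  have _h := hq0
  rw [millerWernerTheta_eq, fkKappa_eq,
    show 4 * π / (4 * π / Real.arccos (-Real.sqrt q / 2)) = Real.arccos (-Real.sqrt q / 2) by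
      field_simp,
    Real.cos_arccos h1 h2]
  ring

/-- `κ(q) ∈ [4, 8]` for `q ∈ [0,4]`. [folklore] -/
theorem fkKappa_mem_Icc {q : ℝ} (hq4 : q ≤ 4) : fkKappa q ∈ Icc (4 : ℝ) 8 := by
  obtain ⟨hlo, hhi⟩ := arccos_fk_mem_Icc hq4
  have hpos : 0 < Real.arccos (-Real.sqrt q / 2) := lt_of_lt_of_le (by positivity) hlo
  rw [fkKappa_eq]
  constructor
  · rw [le_div_iff₀ hpos]
    linarith
  · rw [div_le_iff₀ hpos]
    linarith

/-- Converse direction of the dictionary: for `κ ∈ [4,8]`, `θ_κ ≥ 0` and `κ(θ_κ²) = κ`, i.e.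
`κ = 4π / arccos(-√q/2)` with `q = θ_κ²`. [folklore] -/
theorem fkKappa_millerWernerTheta_sq {κ : ℝ} (hκ : κ ∈ Icc (4 : ℝ) 8) :
    fkKappa (millerWernerTheta κ ^ 2) = κ := by
  have hκ0 : 0 < κ := by linarith [hκ.1]
  have hlo : 0 ≤ 4 * π / κ := by positivity
  have hhi : 4 * π / κ ≤ π := by
    rw [div_le_iff₀ hκ0]
    nlinarith [Real.pi_pos, hκ.1]
  rw [fkKappa_eq, Real.sqrt_sq (millerWernerTheta_nonneg hκ), millerWernerTheta_eq,
    show -(-2 * Real.cos (4 * π / κ)) / 2 = Real.cos (4 * π / κ) by ring,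
    Real.arccos_cos hlo hhi]
  have hπ : π ≠ 0 := Real.pi_pos.ne'
  field_simp

/-- **The FK dictionary** on `q ∈ [0,4]`, `κ ∈ [4,8]`:
`√q = θ_κ = -2cos(4π/κ) ↔ κ = 4π / arccos(-√q/2)`. [cite: Smirnov2007ICM, §2.3 Conjecture 4] -/
theorem sqrt_eq_millerWernerTheta_iff {q κ : ℝ} (hq : q ∈ Icc (0 : ℝ) 4) (hκ : κ ∈ Icc (4 : ℝ) 8) :
    Real.sqrt q = millerWernerTheta κ ↔ κ = fkKappa q := by
  constructor
  · intro h
    have hq' : q = millerWernerTheta κ ^ 2 := by rw [← h, Real.sq_sqrt hq.1]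
    rw [hq', fkKappa_millerWernerTheta_sq hκ]
  · rintro rfl
    exact (millerWernerTheta_fkKappa hq.1 hq.2).symm

/-- `arccos(-1/2) = 2π/3` (via `arccos(1/2) = π/3`, cf.
`Literature.Probability.Percolation.arccos_one_half`). [folklore] -/
theorem arccos_neg_one_half : Real.arccos (-1 / 2) = 2 * π / 3 := by
  rw [neg_div, Real.arccos_neg, ← Real.cos_pi_div_three,
    Real.arccos_cos (by positivity) (by linarith [Real.pi_pos])]
  ring

/-- `arccos(√2/2) = π/4`. [folklore] -/
theorem arccos_sqrt_two_div_two : Real.arccos (Real.sqrt 2 / 2) = π / 4 := by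
  rw [← Real.cos_pi_div_four, Real.arccos_cos (by positivity) (by linarith [Real.pi_pos])]

/-- `κ(0) = 8` (`q → 0`: uniform spanning tree / `CLE₈` boundary case). [folklore] -/
theorem fkKappa_zero : fkKappa 0 = 8 := by
  rw [fkKappa_eq, Real.sqrt_zero, neg_zero, zero_div, Real.arccos_zero]
  have hπ : π ≠ 0 := Real.pi_pos.ne'
  field_simp
  ring

/-- `κ(1) = 6` (critical percolation). [folklore] -/
theorem fkKappa_one : fkKappa 1 = 6 := by
  rw [fkKappa_eq, Real.sqrt_one, arccos_neg_one_half]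
  have hπ : π ≠ 0 := Real.pi_pos.ne'
  field_simp
  ring

/-- `κ(2) = 16/3` (FK-Ising). [folklore] -/
theorem fkKappa_two : fkKappa 2 = 16 / 3 := by
  rw [fkKappa_eq, neg_div, Real.arccos_neg, arccos_sqrt_two_div_two]
  have hπ : π ≠ 0 := Real.pi_pos.ne'
  field_simp
  ring

/-- `κ(4) = 4` (`q = 4`, four-state Potts / `CLE₄`). [folklore] -/
theorem fkKappa_four : fkKappa 4 = 4 := by
  rw [fkKappa_eq, show (4 : ℝ) = 2 ^ 2 by norm_num, Real.sqrt_sq (by norm_num : (0 : ℝ) ≤ 2),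
    show -(2 : ℝ) / 2 = -1 by norm_num, Real.arccos_neg_one]
  have hπ : π ≠ 0 := Real.pi_pos.ne'
  field_simp

/-- `√(3/4) = √3/2`. [folklore] -/
theorem sqrt_three_quarters : Real.sqrt (3 / 4) = Real.sqrt 3 / 2 := by
  rw [Real.sqrt_eq_iff_mul_self_eq (by norm_num) (by positivity)]
  have h := Real.mul_self_sqrt (show (0 : ℝ) ≤ 3 by norm_num)
  nlinarith [h]

/-- **Slope of the dictionary at percolation:** `dκ/dq (q = 1) = -3√3/(2π)` (`≈ -0.8270`); from
`κ(q) = 4π/arccos(-√q/2)`, `arccos(-1/2) = 2π/3`, `arccos' = -1/√(1-u²)`. [folklore] -/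
theorem hasDerivAt_fkKappa_one : HasDerivAt fkKappa (-(3 * Real.sqrt 3) / (2 * π)) 1 := by
  have hA : HasDerivAt (fun q : ℝ => -Real.sqrt q / 2) (-(1 / (2 * Real.sqrt 1)) / 2) 1 :=
    ((Real.hasDerivAt_sqrt one_ne_zero).neg).div_const 2
  have hB : HasDerivAt Real.arccos (-(1 / Real.sqrt (1 - (-Real.sqrt 1 / 2) ^ 2)))
      (-Real.sqrt 1 / 2) :=
    Real.hasDerivAt_arccos (by rw [Real.sqrt_one]; norm_num) (by rw [Real.sqrt_one]; norm_num)
  have hC : HasDerivAt (fun q : ℝ => Real.arccos (-Real.sqrt q / 2))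
      (-(1 / Real.sqrt (1 - (-Real.sqrt 1 / 2) ^ 2)) * (-(1 / (2 * Real.sqrt 1)) / 2)) 1 :=
    HasDerivAt.comp (h₂ := Real.arccos) (h := fun q : ℝ => -Real.sqrt q / 2) 1 hB hA
  have hval : Real.arccos (-Real.sqrt 1 / 2) = 2 * π / 3 := by
    rw [Real.sqrt_one, arccos_neg_one_half]
  have hne : Real.arccos (-Real.sqrt 1 / 2) ≠ 0 := by
    rw [hval]
    positivity
  have hD := (hasDerivAt_const (1 : ℝ) (4 * π)).div hC hne
  have hfun : fkKappa = fun q : ℝ => 4 * π / Real.arccos (-Real.sqrt q / 2) := rfl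
  rw [hfun]
  refine hD.congr_deriv ?_
  rw [hval, Real.sqrt_one, show (1 : ℝ) - (-1 / 2) ^ 2 = 3 / 4 by norm_num, sqrt_three_quarters]
  have hπ : π ≠ 0 := Real.pi_pos.ne'
  have h3 : Real.sqrt 3 ≠ 0 := by positivity
  have h3sq := Real.mul_self_sqrt (show (0 : ℝ) ≤ 3 by norm_num)
  field_simp
  nlinarith [h3sq, Real.pi_pos]

end FK

end Literature.Probability.RandomPlanarGeometry
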